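import Summits.QuantumFields.BalabanUV.Beta.AxialDressingRootedBmKernel

/-!
# PREPARATORY (pending β-lead RULING (R42-1); touches NO wall object): rules 1–2 of the relative inverse for the BLOCK-MEAN co-dressed
# kernels — `axE ∘ G = G = G ∘ axE` for `G := coDressKBmAt (toSite r) N K`

HONEST FRAMING (cell charter, verbatim): «discharging BetaPertH makes Balaban's UV stability UNCONDITIONAL — a real
constructive-QFT result; it is NOT the continuum limit and NOT the Clay problem.»  DERIVED cell leaf (β sub-cell, lane an2 gen 12,
NOTE X-an2-42 repair (A), file 6); no statement of Bałaban's papers, no `[cite:]` tag, no `Prop` fact; instantiates no wall binder.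
NOT `BetaPertH`; NOT continuum; NOT Clay.

## What is here (decl-by-decl twins of `AxialCoordinateProjector` §2 (end) and §3 with `piK ↦ piKBm`)
* `comp_axE_trK_piKBm : comp (axE ρ N) (trK (piKBm ρ N)) = trK (piKBm ρ N)` and `comp_piKBm_axE` — the block-mean projector's matrix has
  no comb rows/columns either (`pmBm_eq_zero_of_isCombBond`, file `AxialDressingRootedBmReflection`);
* `comp_axE_coDressKBmAt`, `comp_coDressKBmAt_axE` (rules 1–2 of `ChartConjugationRelative.RelInv G 𝕄 (axE (toSite r) N)` for any `𝕄`),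
  and `axE_rules_coDressKBmAt_KInvStep` for the block-mean co-dressed step resolvents `G_j := coDressKBmAt (toSite r) Lc (KInvStep Lc j)`.
Rules 3–4 (`(G_j∘𝕄_j)∘E = E = (E∘𝕄_j)∘G_j`, `𝕄_j` the undressed bordered step Hessian) remain the located open item (ii-1); by NOTE
X-an2-42 they are the natural conjecture for THIS (block-mean) dressing and false in mechanism for the comb-root-normalised one.
All declarations `[folklore]`; axioms standard.  Provenance: b2b-balaban β sub-cell, unit beta-an2 gen 12, 2026-08-20.
-/

open Finset
open scoped BigOperators
open Literature.MathematicalPhysics.QuantumFieldTheory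
open Literature.MathematicalPhysics.QuantumFieldTheory.Balaban1983to89
open Literature.MathematicalPhysics.QuantumFieldTheory.Balaban1983to89.Beta
open B12Sec2to5 (l1 l1_nonneg)
open ExpKernelCalculus (MKer Decays BiLoc comp tr shiftK)
open AffineAveraging (Form0 Form1 box toSite unitVec unitVec_apply)
open OneStepResolventKernel (Fib)
open Summit.QuantumFields.BalabanUV.Beta.TameKernelCalculus

namespace Summit.QuantumFields.BalabanUV.Beta.AxialDressingRooted

noncomputable section

/-! ## §1 `axE` fixes the block-mean projector matrix on both sides -/

section AxEBm

variable {d : ℕ} (ρ : Fin (d + 1) → ℤ) (N : ℕ)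

/-- [folklore] **`axE ∘ Πᵀ_bm-matrix = Πᵀ_bm-matrix`**: the block-mean projector's range has no comb rows (`pmBm_eq_zero_of_isCombBond`). -/
theorem comp_axE_trK_piKBm : comp (axE ρ N) (trK (piKBm ρ N)) = trK (piKBm ρ N) := by
  funext x x' a b
  rw [comp_axE_apply]
  rcases a with α | m
  · dsimp only
    split_ifs with hc
    · show (0 : ℝ) = piKBm ρ N x' x b (Sum.inl α)
      rcases b with β | m'
      · rw [piKBm_inl_inl]
        split_ifs
        · rw [pmBm_eq_zero_of_isCombBond hc]
        · rfl
      · rfl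
    · rfl
  · rfl

/-- [folklore] **`Πᵀ_bm ∘ axE = Πᵀ_bm`** on the other side: `comp (piKBm ρ N) (axE ρ N) = piKBm ρ N` (no comb columns). -/
theorem comp_piKBm_axE : comp (piKBm ρ N) (axE ρ N) = piKBm ρ N := by
  funext x x' a b
  rw [comp_axE_apply']
  rcases b with β | m
  · dsimp only
    split_ifs with hc
    · rcases a with α | m'
      · rw [piKBm_inl_inl]
        split_ifs
        · rw [pmBm_eq_zero_of_isCombBond hc]
        · rfl
      · rfl
    · rfl
  · rfl

end AxEBm

/-! ## §2 Rules 1–2 of the relative inverse for the block-mean co-dressed kernel -/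

section RulesBm

variable {d : ℕ}

/-- [folklore] **RULE 1: `E ∘ G = G`** for `G := coDressKBmAt (toSite r) N K` and `E := axE (toSite r) N` (in-block root, spread `K`). -/
theorem comp_axE_coDressKBmAt {N : ℕ} (hN : 1 ≤ N) {r : Fin (d + 1) → ℕ} (hr : r ∈ box (d + 1) N) {K : MKer (d + 1) (Fib d)}
    (hK : Spr K) : comp (axE (toSite r) N) (coDressKBmAt (toSite r) N K) = coDressKBmAt (toSite r) N K := by
  have sE : Spr (axE (d := d) (toSite r) N) := spr_axE _ _
  have sP : Spr (piKBm (d := d) (toSite r) N) := spr_piKBm hN hr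
  have sPt : Spr (trK (piKBm (d := d) (toSite r) N)) := spr_trK_piKBm hN hr
  rw [coDressKBmAt_eq, comp_assoc_tame sE.tame (spr_comp sPt hK).tame sP.tame, comp_assoc_tame sE.tame sPt.tame hK.tame,
    comp_axE_trK_piKBm]

/-- [folklore] **RULE 2: `G ∘ E = G`**. -/
theorem comp_coDressKBmAt_axE {N : ℕ} (hN : 1 ≤ N) {r : Fin (d + 1) → ℕ} (hr : r ∈ box (d + 1) N) {K : MKer (d + 1) (Fib d)}
    (hK : Spr K) : comp (coDressKBmAt (toSite r) N K) (axE (toSite r) N) = coDressKBmAt (toSite r) N K := by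
  have sE : Spr (axE (d := d) (toSite r) N) := spr_axE _ _
  have sP : Spr (piKBm (d := d) (toSite r) N) := spr_piKBm hN hr
  have sPt : Spr (trK (piKBm (d := d) (toSite r) N)) := spr_trK_piKBm hN hr
  rw [coDressKBmAt_eq, ← comp_assoc_tame (spr_comp sPt hK).tame sP.tame sE.tame, comp_piKBm_axE]

/-- [folklore] **RULES 1–2 FOR THE BLOCK-MEAN CO-DRESSED STEP RESOLVENTS** `G_j := coDressKBmAt (toSite r) Lc (KInvStep Lc j)`: the first
two conjuncts of `ChartConjugationRelative.RelInv G_j 𝕄 (axE (toSite r) Lc)` for ANY `𝕄`. -/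
theorem axE_rules_coDressKBmAt_KInvStep {Lc : ℕ} [NeZero Lc] {r : Fin (d + 1) → ℕ} (hr : r ∈ box (d + 1) Lc) (j : ℕ) :
    comp (axE (toSite r) Lc) (coDressKBmAt (toSite r) Lc (OneStepKernelFamily.KInvStep (d := d) Lc j)) =
        coDressKBmAt (toSite r) Lc (OneStepKernelFamily.KInvStep (d := d) Lc j) ∧
      comp (coDressKBmAt (toSite r) Lc (OneStepKernelFamily.KInvStep (d := d) Lc j)) (axE (toSite r) Lc) =
        coDressKBmAt (toSite r) Lc (OneStepKernelFamily.KInvStep (d := d) Lc j) := by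
  obtain ⟨δ, C, hδ, -, hK⟩ := OneStepKernelFamily.decays_KInvStep (d := d) (Lc := Lc) j
  have sK : Spr (OneStepKernelFamily.KInvStep (d := d) Lc j) := ⟨C, δ, hδ, hK⟩
  exact ⟨comp_axE_coDressKBmAt (one_le_of_neZero Lc) hr sK, comp_coDressKBmAt_axE (one_le_of_neZero Lc) hr sK⟩

end RulesBm

end

end Summit.QuantumFields.BalabanUV.Beta.AxialDressingRooted
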